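import Literature.Probability.Percolation.TwoSetConditionalAssociationRC
import HarnessLib

/-!
# Exact evaluation of the edge-parameter random-cluster measure `φ_{w,q}` on a listed finite graph (kernel arithmetic bridge)

Helper file (`--supports stmt-CriticalPhenomena-4575 --as helper`), FK sub-lane `prim-bschramm-fk-3` (the "locate the
`q`-sensitivity" seat of the post-continuity programme); builds on p205010 (kernel theorem, internal audit signed; external expert
review pending).  No named facts, no sorries; standard axioms.

The sub-lane's exact censuses (bschramm/FK-BARRIER.md, FK-Q2.md) decide finite statements about `φ_{w,q} = rcMeasureW w q ∅`
(Grimmett 2006 eq. (1.20); `Literature/Probability/LatticeModels/RandomClusterEdgeWeights.lean`) by exact rational arithmetic; this file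
turns such decisions into KERNEL certificates, in the pattern of `FK.FKGLatticeCex` (`…FKGLatticeRefutation.lean`) but for the
random-cluster weights, whose only non-product ingredient is the cluster count `k(ω)`:
* `FK.RCEval` — a listed weighted graph: vertices `Fin n`, listed pairs `edge i = s(src i, dst i)` (`i : Fin m`) with rational
  parameters `c i` (every unlisted pair, loops included, has parameter `0`), rational cluster weight `q`; `Valid` = pairs distinct,
  `0 ≤ c ≤ 1`, `0 < q` (decidable);
* computable side (`decide +kernel`-evaluable): `adjB / reachWithin / reachB` (open walks), `kB` (number of open clusters = number of
  vertices that are least in their cluster), `wQ` (product weight), `mQ = wQ · q^kB`, `ZQ = Σ mQ`, `massQ P = Σ_{P} mQ`;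
* measure side: the parameter vector `RCEval.w : Sym2 (Fin n) → [0,1]`, the configuration `RCEval.conf t` of open listed pairs
  `t : Finset (Fin m)`, and the bridge under `Valid`: `reachB_iff`, `clusterCount_conf : k(conf t) = kB t` (through the counting lemma
  `natCard_connectedComponent_eq_card_filter`: components of a graph on `Fin n` ↔ vertices `≤` every vertex of their component),
  `rcWeightW_conf`, `rcWeightW_eq_zero_of_not_subset`, the transfer `sum_rcWeightW_mul : Σ_ω w_q(ω) f(ω) = Σ_t mQ t · f(conf t)`,
  and the evaluations `rcPartitionFunctionW_eq : Z = ZQ`, `real_eq_massQ_div : φ(X) = massQ P / ZQ` (for `conf t ∈ X ↔ P t`),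
  `integral_eq_sum_div`, `setIntegral_eq_sum_div`, `sum_mQ_mul_ite`.
First users: `…FKQSensitivityWitnesses.lean` (positive association and vdBHK's one-cluster CPA fail at `q = 1/2`; non-locality at `q = 2`).
[cite: Grimmett2006, §1.4 eq. (1.20) (p. 15); §1.2 eq. (1.1) (cluster count)] [cite: VandenbergHaggstromKahn2005, §2.1 eq. (11) (p. 9)]
-/


namespace Summit.CriticalPhenomena.PercolationContinuityZ3.Theorems

namespace FK

open MeasureTheory Literature.Probability.LatticeModels Literature.Probability.Percolation
open Literature.Probability.Percolation.BHK2006 (weight rcMass integral_rcMeasureW_eq_sum setIntegral_rcMeasureW_eq_sum)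
open Literature.Probability.Percolation.DecisionTree (ind ind_of_mem ind_of_not_mem)

/-! ### A general counting lemma: components of a graph on `Fin n` ↔ minimal vertices of components -/

section Count

open scoped Classical

/-- **The number of connected components of a graph on `Fin n` is the number of vertices that are `≤` every vertex joined to
them** (each component has exactly one least vertex). [folklore] -/
theorem natCard_connectedComponent_eq_card_filter {n : ℕ} (G : SimpleGraph (Fin n)) :
    Nat.card G.ConnectedComponent =
      (Finset.univ.filter fun v : Fin n => ∀ u : Fin n, G.Reachable u v → v ≤ u).card := by
  classical
  let M := {v : Fin n // ∀ u : Fin n, G.Reachable u v → v ≤ u}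
  let f : M → G.ConnectedComponent := fun v => G.connectedComponentMk v.1
  have hf : Function.Bijective f := by
    constructor
    · rintro ⟨v, hv⟩ ⟨v', hv'⟩ h
      have hr : G.Reachable v v' := SimpleGraph.ConnectedComponent.eq.1 h
      have h1 : v' ≤ v := hv' v hr
      have h2 : v ≤ v' := hv v' hr.symm
      exact Subtype.ext (le_antisymm h2 h1)
    · intro c
      induction c using SimpleGraph.ConnectedComponent.ind with
      | h u =>
        let S : Finset (Fin n) := Finset.univ.filter fun x => G.Reachable u x
        have hS : S.Nonempty := ⟨u, by simp [S]⟩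
        have hum : G.Reachable u (S.min' hS) := by simpa [S] using Finset.min'_mem S hS
        refine ⟨⟨S.min' hS, fun u' hu' => Finset.min'_le S u' ?_⟩, SimpleGraph.ConnectedComponent.eq.2 hum.symm⟩
        simpa [S] using hum.trans hu'.symm
  rw [← Nat.card_eq_of_bijective f hf, Nat.card_eq_fintype_card, Fintype.card_subtype]

end Count

/-! ### The data of a listed weighted graph and its computable evaluation -/

/-- **A listed finite weighted graph with rational parameters**: vertices `Fin n`, listed pairs `s(src i, dst i)` (`i : Fin m`)
with parameters `c i`, cluster weight `q`; every unlisted pair has parameter `0`. [cite: Grimmett2006, §1.4 eq. (1.20) (p. 15)] -/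
structure RCEval where
  /-- number of vertices -/ n : ℕ
  /-- number of listed pairs -/ m : ℕ
  /-- first endpoints of the listed pairs -/ src : Fin m → Fin n
  /-- second endpoints of the listed pairs -/ dst : Fin m → Fin n
  /-- parameters of the listed pairs -/ c : Fin m → ℚ
  /-- cluster weight -/ q : ℚ

namespace RCEval

/-- The `i`-th listed pair. [folklore] -/
def edge (D : RCEval) (i : Fin D.m) : Sym2 (Fin D.n) := s(D.src i, D.dst i)

/-- **Validity** of the data `D` (a decidable predicate of the data, checked by `decide` on concrete instances): listed pairs
pairwise distinct, parameters in `[0,1]`, `q > 0`. [folklore] -/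
def Valid (D : RCEval) : Prop := Function.Injective D.edge ∧ (∀ i, 0 ≤ D.c i ∧ D.c i ≤ 1) ∧ 0 < D.q

/-- Validity is decidable. [folklore] -/
instance instDecidableValid (D : RCEval) : Decidable D.Valid := by unfold Valid; infer_instance

variable (D : RCEval)

/-- Adjacency of two distinct vertices through an open listed pair of `t` (computable). [folklore] -/
def adjB (t : Finset (Fin D.m)) (x y : Fin D.n) : Bool :=
  decide (x ≠ y) && (List.finRange D.m).any (fun i => decide (i ∈ t) &&
    ((decide (D.src i = x) && decide (D.dst i = y)) || (decide (D.src i = y) && decide (D.dst i = x))))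

/-- `reachWithin t k u v`: an open walk of length `≤ k` from `u` to `v` (computable). [folklore] -/
def reachWithin (t : Finset (Fin D.m)) : ℕ → Fin D.n → Fin D.n → Bool
  | 0, u, v => decide (u = v)
  | k + 1, u, v => decide (u = v) || (List.finRange D.n).any (fun x => D.adjB t u x && reachWithin t k x v)

/-- Open reachability (walks of length `≤ n` suffice on `n` vertices; computable). [folklore] -/
def reachB (t : Finset (Fin D.m)) (u v : Fin D.n) : Bool := D.reachWithin t D.n u v

/-- `v` is the least vertex of its open cluster (computable). [folklore] -/
def isMinB (t : Finset (Fin D.m)) (v : Fin D.n) : Bool :=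
  (List.finRange D.n).all fun u => !(D.reachB t u v) || decide (v ≤ u)

/-- **The number of open clusters** `k(t)` = number of least vertices (computable). [cite: Grimmett2006, §1.2 eq. (1.1) (p. 4)] -/
def kB (t : Finset (Fin D.m)) : ℕ := (Finset.univ.filter fun v : Fin D.n => D.isMinB t v = true).card

/-- The product weight `∏_i (c_i if i open else 1 - c_i)` (computable). [cite: Grimmett2006, §1.4 eq. (1.20) (p. 15)] -/
def wQ (t : Finset (Fin D.m)) : ℚ := ∏ i : Fin D.m, if i ∈ t then D.c i else 1 - D.c i

/-- **The random-cluster weight** `mQ t = wQ t · q^{k(t)}` (computable). [cite: Grimmett2006, §1.4 eq. (1.20) (p. 15)] -/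
def mQ (t : Finset (Fin D.m)) : ℚ := D.wQ t * D.q ^ D.kB t

/-- The partition function `Z = Σ_t mQ t` (computable). [cite: Grimmett2006, §1.4 eq. (1.20) (p. 15)] -/
def ZQ : ℚ := ∑ t : Finset (Fin D.m), D.mQ t

/-- The unnormalised mass of a computable event. [cite: Grimmett2006, §1.4 eq. (1.20) (p. 15)] -/
def massQ (P : Finset (Fin D.m) → Bool) : ℚ := ∑ t : Finset (Fin D.m), if P t then D.mQ t else 0

noncomputable section

open scoped Classical

/-- **The parameter vector** `w : Sym2 (Fin n) → [0,1]`: `c i` on the listed pair `edge i`, `0` on unlisted pairs (defined by a sum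
over the listed pairs equal to `e`, clamped into `[0,1]`, so that no validity hypothesis is needed to define it).
[cite: Grimmett2006, §1.4 eq. (1.20) (p. 15)] -/
def w (e : Sym2 (Fin D.n)) : unitInterval :=
  ⟨max 0 (min 1 (∑ i ∈ Finset.univ.filter (fun i => D.edge i = e), (D.c i : ℝ))),
    ⟨le_max_left _ _, max_le zero_le_one (min_le_left _ _)⟩⟩

/-- The bond configuration whose open pairs are the listed pairs indexed by `t`. [folklore] -/
def conf (t : Finset (Fin D.m)) : BondConfig (Fin D.n) := ↑(t.image D.edge)

variable {D}

/-- Under validity, the parameter of the listed pair `edge i` is `c i`. [folklore] -/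
theorem w_edge (hD : D.Valid) (i : Fin D.m) : (D.w (D.edge i) : ℝ) = D.c i := by
  have hfilter : (Finset.univ.filter fun j => D.edge j = D.edge i) = {i} := by
    ext j
    simp only [Finset.mem_filter, Finset.mem_univ, true_and, Finset.mem_singleton]
    exact ⟨fun h => hD.1 h, fun h => h ▸ rfl⟩
  have h0 : (0 : ℝ) ≤ D.c i := by exact_mod_cast (hD.2.1 i).1
  have h1 : (D.c i : ℝ) ≤ 1 := by exact_mod_cast (hD.2.1 i).2
  change max 0 (min 1 _) = _
  rw [hfilter, Finset.sum_singleton, min_eq_right h1, max_eq_right h0]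

/-- An unlisted pair has parameter `0`. [folklore] -/
theorem w_eq_zero_of_notMem_range {e : Sym2 (Fin D.n)} (he : e ∉ Set.range D.edge) : (D.w e : ℝ) = 0 := by
  have hfilter : (Finset.univ.filter fun j => D.edge j = e) = ∅ := by
    ext j
    simp only [Finset.mem_filter, Finset.mem_univ, true_and, Finset.notMem_empty, iff_false]
    exact fun h => he ⟨j, h⟩
  change max 0 (min 1 _) = _
  rw [hfilter, Finset.sum_empty, min_eq_right zero_le_one, max_self]

/-- Membership of a listed pair in `conf t`. [folklore] -/
theorem edge_mem_conf (hD : D.Valid) (t : Finset (Fin D.m)) (i : Fin D.m) : D.edge i ∈ D.conf t ↔ i ∈ t := by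
  unfold conf
  rw [Finset.mem_coe, Finset.mem_image]
  exact ⟨fun ⟨j, hj, hji⟩ => hD.1 hji ▸ hj, fun h => ⟨i, h, rfl⟩⟩

/-- `conf t` uses listed pairs only. [folklore] -/
theorem conf_subset_range (t : Finset (Fin D.m)) : D.conf t ⊆ Set.range D.edge := fun e he => by
  obtain ⟨i, _, rfl⟩ := Finset.mem_image.1 (Finset.mem_coe.1 he)
  exact ⟨i, rfl⟩

/-- `conf` is injective under validity. [folklore] -/
theorem conf_injective (hD : D.Valid) : Function.Injective D.conf := by
  intro s t h
  ext i
  rw [← edge_mem_conf hD s i, ← edge_mem_conf hD t i, h]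

/-- A configuration made of listed pairs is a `conf t`. [folklore] -/
theorem exists_conf_eq_of_subset {ω : BondConfig (Fin D.n)} (hω : ω ⊆ Set.range D.edge) : ∃ t, D.conf t = ω := by
  refine ⟨Finset.univ.filter fun i => D.edge i ∈ ω, Set.ext fun e => ?_⟩
  unfold conf
  rw [Finset.mem_coe, Finset.mem_image]
  refine ⟨fun ⟨i, hi, he⟩ => he ▸ (Finset.mem_filter.1 hi).2, fun he => ?_⟩
  obtain ⟨i, rfl⟩ := hω he
  exact ⟨i, Finset.mem_filter.2 ⟨Finset.mem_univ _, he⟩, rfl⟩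

/-! ### Correctness of the computable reachability and cluster count -/

/-- `adjB` computes adjacency in the open graph of `conf t`. [folklore] -/
theorem adjB_iff (t : Finset (Fin D.m)) (x y : Fin D.n) :
    D.adjB t x y = true ↔ (openGraph (D.conf t)).Adj x y := by
  rw [openGraph_adj]
  unfold conf
  rw [Finset.mem_coe, Finset.mem_image]
  simp only [adjB, Bool.and_eq_true, decide_eq_true_eq, List.any_eq_true, List.mem_finRange, true_and,
    Bool.or_eq_true]
  constructor
  · rintro ⟨hne, i, hi, h⟩
    refine ⟨⟨i, hi, ?_⟩, hne⟩
    change s(D.src i, D.dst i) = s(x, y)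
    rcases h with ⟨h1, h2⟩ | ⟨h1, h2⟩
    · rw [h1, h2]
    · rw [h1, h2, Sym2.eq_swap]
  · rintro ⟨⟨i, hi, h⟩, hne⟩
    refine ⟨hne, i, hi, ?_⟩
    change s(D.src i, D.dst i) = s(x, y) at h
    rw [Sym2.eq_iff] at h
    rcases h with ⟨h1, h2⟩ | ⟨h1, h2⟩
    · exact Or.inl ⟨h1, h2⟩
    · exact Or.inr ⟨h1, h2⟩

/-- `reachWithin t k u v` holds iff there is an open walk of length `≤ k` from `u` to `v`. [folklore] -/
theorem reachWithin_iff (t : Finset (Fin D.m)) (k : ℕ) (u v : Fin D.n) :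
    D.reachWithin t k u v = true ↔ ∃ p : (openGraph (D.conf t)).Walk u v, p.length ≤ k := by
  induction k generalizing u with
  | zero =>
    simp only [reachWithin, decide_eq_true_eq, Nat.le_zero]
    constructor
    · rintro rfl; exact ⟨SimpleGraph.Walk.nil, rfl⟩
    · rintro ⟨p, hp⟩; exact (SimpleGraph.Walk.eq_of_length_eq_zero hp)
  | succ k ih =>
    simp only [reachWithin, Bool.or_eq_true, decide_eq_true_eq, List.any_eq_true, List.mem_finRange, true_and,
      Bool.and_eq_true, adjB_iff, ih]
    constructor
    · rintro (rfl | ⟨x, hx, p, hp⟩)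
      · exact ⟨SimpleGraph.Walk.nil, Nat.zero_le _⟩
      · exact ⟨SimpleGraph.Walk.cons hx p, by rw [SimpleGraph.Walk.length_cons]; omega⟩
    · rintro ⟨p, hp⟩
      cases p with
      | nil => exact Or.inl rfl
      | cons h p' =>
        refine Or.inr ⟨_, h, p', ?_⟩
        rw [SimpleGraph.Walk.length_cons] at hp
        omega

/-- **`reachB` computes open reachability** (a path on `n` vertices has length `< n`). [folklore] -/
theorem reachB_iff (t : Finset (Fin D.m)) (u v : Fin D.n) :
    D.reachB t u v = true ↔ (openGraph (D.conf t)).Reachable u v := by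
  rw [reachB, reachWithin_iff]
  refine ⟨fun ⟨p, _⟩ => ⟨p⟩, fun h => ?_⟩
  obtain ⟨p, hp⟩ := h.exists_isPath
  have := hp.length_lt
  simp only [Fintype.card_fin] at this
  exact ⟨p, by omega⟩

/-- `isMinB` computes "least vertex of its open cluster". [folklore] -/
theorem isMinB_iff (t : Finset (Fin D.m)) (v : Fin D.n) :
    D.isMinB t v = true ↔ ∀ u : Fin D.n, (openGraph (D.conf t)).Reachable u v → v ≤ u := by
  simp only [isMinB, List.all_eq_true, List.mem_finRange, true_implies, Bool.or_eq_true, Bool.not_eq_true',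
    decide_eq_true_eq]
  constructor
  · intro h u hu
    rcases h u with h' | h'
    · exact absurd ((reachB_iff t u v).2 hu) (by rw [h']; exact Bool.false_ne_true)
    · exact h'
  · intro h u
    by_cases hr : D.reachB t u v = true
    · exact Or.inr (h u ((reachB_iff t u v).1 hr))
    · exact Or.inl (Bool.eq_false_iff.2 hr)

/-- **`kB` computes the tree's cluster count** `clusterCount (conf t) ∅` (free boundary). [cite: Grimmett2006, §1.2 eq. (1.1) (p. 4)] -/
theorem clusterCount_conf (t : Finset (Fin D.m)) : clusterCount (D.conf t) ∅ = D.kB t := by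
  unfold clusterCount kB
  rw [wired_empty, sup_bot_eq, natCard_connectedComponent_eq_card_filter]
  congr 1
  exact Finset.filter_congr fun v _ => (isMinB_iff t v).symm

/-- The product weight of `conf t` is `wQ t`. [cite: Grimmett2006, §1.4 eq. (1.20) (p. 15)] -/
theorem weight_conf (hD : D.Valid) (t : Finset (Fin D.m)) :
    weight (fun e => (D.w e : ℝ)) (D.conf t) = (D.wQ t : ℝ) := by
  unfold weight wQ
  have hsub : Finset.univ.image D.edge ⊆ (Finset.univ : Finset (Sym2 (Fin D.n))) := Finset.subset_univ _
  rw [← Finset.prod_subset hsub]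
  · rw [Finset.prod_image fun i _ j _ h => hD.1 h, Rat.cast_prod]
    refine Finset.prod_congr rfl fun i _ => ?_
    dsimp only
    rw [w_edge hD i]
    by_cases hi : i ∈ t
    · rw [if_pos ((edge_mem_conf hD t i).2 hi), if_pos hi]
    · rw [if_neg (fun h => hi ((edge_mem_conf hD t i).1 h)), if_neg hi, Rat.cast_sub, Rat.cast_one]
  · intro e _ he
    have he' : e ∉ Set.range D.edge := by
      rintro ⟨i, rfl⟩
      exact he (Finset.mem_image.2 ⟨i, Finset.mem_univ _, rfl⟩)
    dsimp only
    rw [if_neg (fun h => he' (conf_subset_range t h)), w_eq_zero_of_notMem_range he', sub_zero]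

/-- **The random-cluster weight of `conf t` is `mQ t`.** [cite: Grimmett2006, §1.4 eq. (1.20) (p. 15)] -/
theorem rcWeightW_conf (hD : D.Valid) (t : Finset (Fin D.m)) :
    rcWeightW D.w (D.q : ℝ) ∅ (D.conf t) = (D.mQ t : ℝ) := by
  unfold rcWeightW mQ
  rw [weight_conf hD t, clusterCount_conf t]
  push_cast
  rfl

/-- A configuration using an unlisted pair has random-cluster weight `0`. [cite: Grimmett2006, §1.4 eq. (1.20) (p. 15)] -/
theorem rcWeightW_eq_zero_of_not_subset {ω : BondConfig (Fin D.n)} (hω : ¬ ω ⊆ Set.range D.edge) :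
    rcWeightW D.w (D.q : ℝ) ∅ ω = 0 := by
  obtain ⟨e, heω, he⟩ := Set.not_subset.1 hω
  unfold rcWeightW weight
  rw [Finset.prod_eq_zero (Finset.mem_univ e) (by dsimp only; rw [if_pos heω, w_eq_zero_of_notMem_range he]), zero_mul]

/-- **Transfer**: a weighted sum over all configurations is the computable sum over the listed-pair configurations.
[cite: Grimmett2006, §1.4 eq. (1.20) (p. 15)] -/
theorem sum_rcWeightW_mul (hD : D.Valid) (f : BondConfig (Fin D.n) → ℝ) :
    ∑ ω : BondConfig (Fin D.n), rcWeightW D.w (D.q : ℝ) ∅ ω * f ω =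
      ∑ t : Finset (Fin D.m), (D.mQ t : ℝ) * f (D.conf t) := by
  have hsub : Finset.univ.image D.conf ⊆ (Finset.univ : Finset (BondConfig (Fin D.n))) := Finset.subset_univ _
  rw [← Finset.sum_subset hsub]
  · rw [Finset.sum_image fun s _ t _ h => conf_injective hD h]
    exact Finset.sum_congr rfl fun t _ => by rw [rcWeightW_conf hD t]
  · intro ω _ hω
    have hω' : ¬ ω ⊆ Set.range D.edge := by
      intro h
      obtain ⟨t, rfl⟩ := exists_conf_eq_of_subset h
      exact hω (Finset.mem_image.2 ⟨t, Finset.mem_univ _, rfl⟩)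
    rw [rcWeightW_eq_zero_of_not_subset hω', zero_mul]

/-- **The partition function is `ZQ`.** [cite: Grimmett2006, §1.4 eq. (1.20) (p. 15)] -/
theorem rcPartitionFunctionW_eq (hD : D.Valid) : rcPartitionFunctionW D.w (D.q : ℝ) ∅ = (D.ZQ : ℝ) := by
  unfold rcPartitionFunctionW ZQ
  have h := sum_rcWeightW_mul hD (fun _ => 1)
  simp only [mul_one] at h
  rw [h, Rat.cast_sum]

/-- `ZQ > 0` under validity. [cite: Grimmett2006, §1.4 eq. (1.20) (p. 15)] -/
theorem zQ_pos (hD : D.Valid) : (0 : ℝ) < (D.ZQ : ℝ) := by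
  rw [← rcPartitionFunctionW_eq hD]
  exact rcPartitionFunctionW_pos D.w (by exact_mod_cast hD.2.2) ∅

/-- **The measure of an event described by a computable predicate**: `φ(X) = massQ P / ZQ`.
[cite: Grimmett2006, §1.4 eq. (1.20) (p. 15)] -/
theorem real_eq_massQ_div (hD : D.Valid) {X : Set (BondConfig (Fin D.n))} {P : Finset (Fin D.m) → Bool}
    (h : ∀ t, D.conf t ∈ X ↔ P t = true) :
    (rcMeasureW D.w (D.q : ℝ) ∅).real X = ((D.massQ P / D.ZQ : ℚ) : ℝ) := by
  have hq : (0 : ℝ) < (D.q : ℝ) := by exact_mod_cast hD.2.2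
  rw [rcMeasureW_real_eq_sum_div D.w hq ∅ X, sum_rcWeightW_mul hD, rcPartitionFunctionW_eq hD]
  push_cast
  congr 1
  unfold massQ
  push_cast
  refine Finset.sum_congr rfl fun t _ => ?_
  by_cases hP : P t = true
  · rw [if_pos hP, ind_of_mem ((h t).2 hP), mul_one]
  · rw [if_neg hP, ind_of_not_mem (fun hX => hP ((h t).1 hX)), mul_zero, Rat.cast_zero]

/-- **Integrals as computable sums**: `∫ h dφ = (Σ_t mQ t · h(conf t)) / ZQ`. [cite: VandenbergHaggstromKahn2005, §2.1 eq. (11) (p. 9)] -/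
theorem integral_eq_sum_div (hD : D.Valid) (h : BondConfig (Fin D.n) → ℝ) :
    ∫ ω, h ω ∂(rcMeasureW D.w (D.q : ℝ) ∅) =
      (∑ t : Finset (Fin D.m), (D.mQ t : ℝ) * h (D.conf t)) / (D.ZQ : ℝ) := by
  have hq : (0 : ℝ) < (D.q : ℝ) := by exact_mod_cast hD.2.2
  rw [integral_rcMeasureW_eq_sum D.w hq h]
  unfold rcMass
  simp only [div_mul_eq_mul_div]
  rw [← Finset.sum_div, sum_rcWeightW_mul hD, rcPartitionFunctionW_eq hD]

/-- **Restricted integrals as computable sums**: `∫_X h dφ = (Σ_t mQ t · h(conf t) · [P t]) / ZQ` for `conf t ∈ X ↔ P t`.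
[cite: VandenbergHaggstromKahn2005, §2.1 eq. (11) (p. 9)] -/
theorem setIntegral_eq_sum_div (hD : D.Valid) (h : BondConfig (Fin D.n) → ℝ) {X : Set (BondConfig (Fin D.n))}
    {P : Finset (Fin D.m) → Bool} (hP : ∀ t, D.conf t ∈ X ↔ P t = true) :
    ∫ ω in X, h ω ∂(rcMeasureW D.w (D.q : ℝ) ∅) =
      (∑ t : Finset (Fin D.m), (D.mQ t : ℝ) * (if P t then h (D.conf t) else 0)) / (D.ZQ : ℝ) := by
  have hq : (0 : ℝ) < (D.q : ℝ) := by exact_mod_cast hD.2.2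
  rw [setIntegral_rcMeasureW_eq_sum D.w hq h X]
  unfold rcMass
  simp only [div_mul_eq_mul_div]
  rw [← Finset.sum_div, sum_rcWeightW_mul hD (fun ω => h ω * ind X ω), rcPartitionFunctionW_eq hD]
  congr 1
  refine Finset.sum_congr rfl fun t _ => ?_
  by_cases ht : P t = true
  · rw [if_pos ht, ind_of_mem ((hP t).2 ht), mul_one]
  · rw [if_neg ht, ind_of_not_mem (fun hX => ht ((hP t).1 hX)), mul_zero, mul_zero]

/-- The computable sum of `mQ` against a `0/1` functional is a `massQ`. [folklore] -/
theorem sum_mQ_mul_ite (P : Finset (Fin D.m) → Bool) :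
    ∑ t : Finset (Fin D.m), (D.mQ t : ℝ) * (if P t then (1 : ℝ) else 0) = (D.massQ P : ℝ) := by
  unfold massQ
  push_cast
  refine Finset.sum_congr rfl fun t _ => ?_
  split_ifs <;> simp

end

end RCEval

end FK

end Summit.CriticalPhenomena.PercolationContinuityZ3.Theorems
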